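import Summits.ValiantsHypothesis.ValiantsHypothesis.Theorems.DefinabilityGapShiftedPrimes
import HarnessLib

/-!
# DefinabilityGap — PATTERN PERMANENTS: the permanent with `≤ n − 2` zeroed entries is irreducible

Route `route-ValiantsHypothesis-DefinabilityGap` (decomp-valiant cycle 1, lens 5: hardness–randomness / PIT axis); the
algebra behind the SPARSITY rung `DefinabilityGapSparsityRung` (census cells W5 / W19 = the size road of the residual
`KIPlantedHitting`, stmt-ValiantsHypothesis-23547, and F4 / W10 = `KIPlantedHittingRO`, stmt-ValiantsHypothesis-23704).

For a set `N` of cells of the `n × n` board, the PATTERN PERMANENT `per_N := Σ_{ρ avoiding N} ∏_i y_{ρ i, i}` is the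
permanent of the generic matrix with the entries in `N` replaced by `0` (`killVars_perPoly`). Zeroing the cells of one
block of the KI design degrades every other block permanent to such a pattern permanent with `≤ 2` more zeros; the
zero-out induction of the sparsity rung needs them to stay PRIME. This file proves:

* `exists_perm_through_avoids` (Hall step): if `|N| + 2 ≤ n` and the cell `x` is free, some permutation through `x`
  avoids `N` (Hall's marriage theorem `Finset.all_card_le_biUnion_card_iff_exists_injective` on the minor of `x`: a
  deficient row set `A` would put `≥ (n − |A|)·|A| ≥ n − 1` cells into `N`).
* `perPat_irreducible`: for `|N| + 2 ≤ n` the pattern permanent is irreducible over any integral domain — von zur Gathen's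
  variable-splitting proof [Vonzurgathen1987, Thm. 3.4] (`perPoly_irreducible`) run with `N`-avoiding permutations: hybrid
  monomials of two avoiding permutations are permutation monomials, the variable set of a factor is closed under row and
  column moves between FREE cells, and any two free cells are joined by such moves through a column free in both rows.
  (Sharp: `n − 1` zeros in a row make `per_N = y · per_{n−1}` reducible.)
* bookkeeping: `coeff_permMonomial_perPat`, `degreeOf_perPat_*`, `perPat_ne_zero`, `perPat_univ`.
0 sorry.
-/

noncomputable section

open MvPolynomial
open Literature.Computability.AlgebraicComplexity

namespace Summit.ValiantsHypothesis.ValiantsHypothesis.Theorems.DefinabilityGapPatternPermanent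

variable {n : Type*} [Fintype n] [DecidableEq n]

/-! ## 1. Permutations through a free cell avoiding a small pattern (Hall) -/

/-- `ρ` AVOIDS the cell set `N`: no cell `(ρ i, i)` of its permutation monomial lies in `N`. [this file] -/
abbrev Avoids (N : Finset (n × n)) (ρ : Equiv.Perm n) : Prop := ∀ i, (ρ i, i) ∉ N

/-- A pattern with fewer than `n` cells misses a whole column. [folklore] -/
theorem exists_col_notMem (N : Finset (n × n)) (hN : N.card < Fintype.card n) :
    ∃ c : n, ∀ r, (r, c) ∉ N := by
  classical
  have h : (N.image Prod.snd).card < (Finset.univ : Finset n).card :=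
    Finset.card_image_le.trans_lt (by rwa [Finset.card_univ])
  obtain ⟨c, -, hc⟩ := Finset.exists_mem_notMem_of_card_lt_card h
  exact ⟨c, fun r hr => hc (Finset.mem_image.2 ⟨(r, c), hr, rfl⟩)⟩

/-- **Hall step.** If `|N| + 2 ≤ n` and the cell `x = (r₀, c₀)` is free, there is a permutation `ρ` with `ρ c₀ = r₀`
whose cells all avoid `N`. [folklore] -/
theorem exists_perm_through_avoids (N : Finset (n × n)) (hN : N.card + 2 ≤ Fintype.card n)
    (x : n × n) (hx : x ∉ N) : ∃ ρ : Equiv.Perm n, ρ x.2 = x.1 ∧ Avoids N ρ := by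
  classical
  obtain ⟨r₀, c₀⟩ := x
  -- columns other than `c₀`, each with its set of admissible rows (not `r₀`, cell free)
  let t : {c : n // c ≠ c₀} → Finset n := fun c => Finset.univ.filter fun r => r ≠ r₀ ∧ (r, (c : n)) ∉ N
  have hall : ∀ s : Finset {c : n // c ≠ c₀}, s.card ≤ (s.biUnion t).card := by
    intro s
    by_contra hlt
    push Not at hlt
    set U := s.biUnion t with hU
    have hUsub : U ⊆ Finset.univ.erase r₀ := by
      intro r hr
      obtain ⟨c, -, hc⟩ := Finset.mem_biUnion.1 hr
      exact Finset.mem_erase.2 ⟨(Finset.mem_filter.1 hc).2.1, Finset.mem_univ _⟩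
    set Bad := Finset.univ.erase r₀ \ U with hBad
    have hBadU : Bad.card + U.card = Fintype.card n - 1 := by
      rw [hBad, Finset.card_sdiff_add_card_eq_card hUsub, Finset.card_erase_of_mem (Finset.mem_univ _),
        Finset.card_univ]
    -- every cell `(r, c)` with `r` bad and `c ∈ s` lies in `N`
    have hsub : Bad ×ˢ s.map (Function.Embedding.subtype _) ⊆ N := by
      intro ⟨r, c⟩ hrc
      rw [Finset.mem_product] at hrc
      obtain ⟨hr, hc⟩ := hrc
      obtain ⟨c', hc's, rfl⟩ := Finset.mem_map.1 hc
      rw [hBad, Finset.mem_sdiff, Finset.mem_erase] at hr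
      by_contra hN'
      exact hr.2 (Finset.mem_biUnion.2 ⟨c', hc's, Finset.mem_filter.2 ⟨Finset.mem_univ _, hr.1.1, hN'⟩⟩)
    have hcardN : Bad.card * s.card ≤ N.card := by
      have := Finset.card_le_card hsub
      rwa [Finset.card_product, Finset.card_map] at this
    have hs : s.card ≤ Fintype.card n - 1 := by
      have : (s.map (Function.Embedding.subtype (· ≠ c₀))).card ≤ (Finset.univ.erase c₀).card :=
        Finset.card_le_card fun c hc => by
          obtain ⟨c', -, rfl⟩ := Finset.mem_map.1 hc
          exact Finset.mem_erase.2 ⟨c'.2, Finset.mem_univ _⟩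
      rwa [Finset.card_map, Finset.card_erase_of_mem (Finset.mem_univ _), Finset.card_univ] at this
    have hs1 : 1 ≤ s.card := by omega
    obtain ⟨d, hd⟩ := Nat.exists_eq_add_of_le (show s.card + 1 ≤ Fintype.card n by omega)
    have hBad1 : d + 1 ≤ Bad.card := by omega
    have h1 : (d + 1) * s.card ≤ N.card := (Nat.mul_le_mul_right _ hBad1).trans hcardN
    nlinarith [Nat.mul_le_mul_left d hs1]
  obtain ⟨f, hf_inj, hf_mem⟩ := (Finset.all_card_le_biUnion_card_iff_exists_injective t).1 hall
  have hf1 : ∀ c, f c ≠ r₀ := fun c => (Finset.mem_filter.1 (hf_mem c)).2.1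
  have hf2 : ∀ c, (f c, (c : n)) ∉ N := fun c => (Finset.mem_filter.1 (hf_mem c)).2.2
  -- extend to all columns by `c₀ ↦ r₀`
  let g : n → n := fun c => if h : c = c₀ then r₀ else f ⟨c, h⟩
  have hg_inj : Function.Injective g := by
    intro c c' hcc'
    by_cases hc : c = c₀ <;> by_cases hc' : c' = c₀
    · rw [hc, hc']
    · exfalso
      simp only [g, dif_pos hc, dif_neg hc'] at hcc'
      exact hf1 ⟨c', hc'⟩ hcc'.symm
    · exfalso
      simp only [g, dif_neg hc, dif_pos hc'] at hcc'
      exact hf1 ⟨c, hc⟩ hcc'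
    · simp only [g, dif_neg hc, dif_neg hc'] at hcc'
      exact congrArg Subtype.val (hf_inj hcc')
  refine ⟨Equiv.ofBijective g (Finite.injective_iff_bijective.1 hg_inj), ?_, fun i => ?_⟩
  · show g c₀ = r₀
    simp [g]
  · show (g i, i) ∉ N
    by_cases hi : i = c₀
    · subst hi
      simp only [g, dif_pos rfl]
      exact hx
    · simp only [g, dif_neg hi]
      exact hf2 ⟨i, hi⟩

/-- A small pattern is avoided by some permutation. [folklore] -/
theorem exists_avoids (N : Finset (n × n)) (hN : N.card + 2 ≤ Fintype.card n) : ∃ ρ : Equiv.Perm n, Avoids N ρ := by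
  obtain ⟨c, hc⟩ := exists_col_notMem N (by omega)
  obtain ⟨ρ, -, hρ⟩ := exists_perm_through_avoids N hN (c, c) (hc c)
  exact ⟨ρ, hρ⟩

/-! ## 2. Pattern permanents -/

section Pattern

variable (R : Type*) [CommRing R]

/-- Kill the variables in `N` (substitute `0`). [this file] -/
def killVars (N : Finset (n × n)) : MvPolynomial (n × n) R →ₐ[R] MvPolynomial (n × n) R :=
  aeval fun v => if v ∈ N then 0 else X v

/-- The PATTERN PERMANENT `per_N = Σ_{ρ avoiding N} y^{μ_ρ}`. [this file] -/
def perPat (N : Finset (n × n)) : MvPolynomial (n × n) R :=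
  ∑ ρ : Equiv.Perm n, if Avoids N ρ then monomial (permMonomial ρ) 1 else 0

omit [Fintype n] in
/-- Killing acts on variables as advertised. [this file] -/
theorem killVars_X (N : Finset (n × n)) (v : n × n) : killVars R N (X v) = if v ∈ N then 0 else X v := by
  rw [killVars, aeval_X]

omit [DecidableEq n] in
/-- `∏_i y_{ρ i, i} = y^{μ_ρ}`. [folklore] -/
theorem prod_X_eq_monomial_permMonomial (ρ : Equiv.Perm n) :
    ∏ i, (X (ρ i, i) : MvPolynomial (n × n) R) = monomial (permMonomial ρ) 1 := by
  rw [permMonomial, monomial_sum_one]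
  rfl

/-- **`per_N` is the permanent with the entries in `N` zeroed.** [this file] -/
theorem killVars_perPoly (N : Finset (n × n)) : killVars R N (perPoly n R) = perPat R N := by
  rw [perPoly_eq_sum_monomial, map_sum, perPat]
  refine Finset.sum_congr rfl fun ρ _ => ?_
  rw [← prod_X_eq_monomial_permMonomial, map_prod]
  simp_rw [killVars_X]
  split_ifs with h
  · exact Finset.prod_congr rfl fun i _ => if_neg (h i)
  · simp only [Avoids, not_forall, not_not] at h
    obtain ⟨i, hi⟩ := h
    exact Finset.prod_eq_zero (Finset.mem_univ i) (if_pos hi)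

/-- The coefficients of `per_N`. [this file] -/
theorem coeff_perPat (N : Finset (n × n)) (d : (n × n) →₀ ℕ) :
    coeff d (perPat R N) = ∑ ρ : Equiv.Perm n, if Avoids N ρ ∧ permMonomial ρ = d then (1 : R) else 0 := by
  rw [perPat, coeff_sum]
  refine Finset.sum_congr rfl fun ρ _ => ?_
  by_cases h : Avoids N ρ
  · rw [if_pos h, coeff_monomial]
    by_cases hd : permMonomial ρ = d
    · rw [if_pos hd, if_pos ⟨h, hd⟩]
    · rw [if_neg hd, if_neg fun h2 => hd h2.2]
  · rw [if_neg h, coeff_zero, if_neg fun h2 => h h2.1]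

/-- The coefficient of a permutation monomial in `per_N` is `[ρ avoids N]`. [this file] -/
theorem coeff_permMonomial_perPat (N : Finset (n × n)) (ρ : Equiv.Perm n) :
    coeff (permMonomial ρ) (perPat R N) = if Avoids N ρ then 1 else 0 := by
  rw [coeff_perPat, Finset.sum_eq_single ρ]
  · simp
  · intro π _ hπ
    simp [permMonomial_injective.ne hπ]
  · simp

/-- The support of `per_N` consists of the monomials of avoiding permutations. [this file] -/
theorem exists_of_coeff_perPat_ne_zero {N : Finset (n × n)} {d : (n × n) →₀ ℕ} (h : coeff d (perPat R N) ≠ 0) :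
    ∃ ρ : Equiv.Perm n, Avoids N ρ ∧ permMonomial ρ = d := by
  by_contra hne
  push Not at hne
  apply h
  rw [coeff_perPat]
  exact Finset.sum_eq_zero fun ρ _ => if_neg fun h2 => hne ρ h2.1 h2.2

/-- `per_N` is multilinear. [this file] -/
theorem degreeOf_perPat_le (N : Finset (n × n)) (v : n × n) : degreeOf v (perPat R N) ≤ 1 := by
  rw [degreeOf_le_iff]
  intro d hd
  obtain ⟨ρ, -, rfl⟩ := exists_of_coeff_perPat_ne_zero R (mem_support_iff.1 hd)
  obtain ⟨r, c⟩ := v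
  rw [permMonomial_apply]
  split_ifs <;> simp

/-- The killed variables do not occur in `per_N`. [this file] -/
theorem degreeOf_perPat_of_mem (N : Finset (n × n)) {v : n × n} (hv : v ∈ N) : degreeOf v (perPat R N) = 0 := by
  apply Nat.eq_zero_of_le_zero
  rw [degreeOf_le_iff]
  intro d hd
  obtain ⟨ρ, hρ, rfl⟩ := exists_of_coeff_perPat_ne_zero R (mem_support_iff.1 hd)
  obtain ⟨r, c⟩ := v
  rw [permMonomial_apply, if_neg fun h => hρ c (by rw [h]; exact hv)]

/-- Every free variable occurs (with degree `1`) in `per_N` when `|N| + 2 ≤ n`. [this file] -/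
theorem degreeOf_perPat_of_notMem [Nontrivial R] (N : Finset (n × n)) (hN : N.card + 2 ≤ Fintype.card n) {v : n × n}
    (hv : v ∉ N) : degreeOf v (perPat R N) = 1 := by
  apply le_antisymm (degreeOf_perPat_le R N v)
  obtain ⟨ρ, hρv, hρ⟩ := exists_perm_through_avoids N hN v hv
  have hmem : permMonomial ρ ∈ (perPat R N).support := by
    rw [mem_support_iff, coeff_permMonomial_perPat, if_pos hρ]; exact one_ne_zero
  have := monomial_le_degreeOf v hmem
  obtain ⟨r, c⟩ := v
  rwa [permMonomial_apply, if_pos hρv] at this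

/-- `per_N ≠ 0` for a small pattern. [this file] -/
theorem perPat_ne_zero [Nontrivial R] (N : Finset (n × n)) (hN : N.card + 2 ≤ Fintype.card n) : perPat R N ≠ 0 := by
  obtain ⟨ρ, hρ⟩ := exists_avoids N hN
  intro h0
  have := coeff_permMonomial_perPat R N ρ
  rw [h0, coeff_zero, if_pos hρ] at this
  exact zero_ne_one this

/-- Killing every variable kills the permanent. [this file] -/
theorem perPat_univ [Nonempty n] : perPat R (Finset.univ : Finset (n × n)) = 0 := by
  rw [perPat]
  refine Finset.sum_eq_zero fun ρ _ => if_neg fun h => ?_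
  obtain ⟨i⟩ := ‹Nonempty n›
  exact h i (Finset.mem_univ _)

/-- … hence so does every pattern containing all cells. [this file] -/
theorem perPat_eq_zero_of_univ_subset [Nonempty n] {N : Finset (n × n)} (h : Finset.univ ⊆ N) : perPat R N = 0 := by
  rw [Finset.univ_subset_iff.1 h]
  exact perPat_univ R

end Pattern

/-! ## 3. Irreducibility (von zur Gathen's argument with avoiding permutations) -/

section Irreducible

variable {R : Type*} [CommRing R] [IsDomain R]

/-- Key step: if `g h = per_N` (`|N| + 2 ≤ n`), the set of variables occurring in `g` is empty or all free cells —
so one factor is constant. [cite: Vonzurgathen1987, Thm. 3.4] -/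
theorem vars_factor_perPat_trivial (N : Finset (n × n)) (hN : N.card + 2 ≤ Fintype.card n)
    {g h : MvPolynomial (n × n) R} (hgh : g * h = perPat R N) :
    (∀ d ∈ g.support, d = 0) ∨ (∀ d ∈ h.support, d = 0) := by
  classical
  have hne : g * h ≠ 0 := by rw [hgh]; exact perPat_ne_zero R N hN
  have hg0 : g ≠ 0 := left_ne_zero_of_mul hne
  have hh0 : h ≠ 0 := right_ne_zero_of_mul hne
  have hdeg : ∀ v, degreeOf v g + degreeOf v h ≤ 1 := fun v => by
    rw [← degreeOf_mul_eq hg0 hh0, hgh]; exact degreeOf_perPat_le R N v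
  have hdegN : ∀ v ∈ N, degreeOf v g + degreeOf v h = 0 := fun v hv => by
    rw [← degreeOf_mul_eq hg0 hh0, hgh]; exact degreeOf_perPat_of_mem R N hv
  set S : Finset (n × n) := Finset.univ.filter fun v => degreeOf v g ≠ 0 with hS
  have hgS : ∀ d ∈ g.support, ∀ v, d v ≠ 0 → v ∈ S := fun d hd v hv => by
    rw [hS, Finset.mem_filter]
    refine ⟨Finset.mem_univ _, fun h0 => hv ?_⟩
    have := monomial_le_degreeOf v hd
    omega
  have hhS : ∀ d ∈ h.support, ∀ v, d v ≠ 0 → v ∉ S := fun d hd v hv hvS => by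
    rw [hS, Finset.mem_filter] at hvS
    have h1 := monomial_le_degreeOf v hd
    have h2 := hdeg v
    omega
  have hSfree : ∀ v ∈ S, v ∉ N := fun v hv hvN => by
    rw [hS, Finset.mem_filter] at hv
    have := hdegN v hvN
    omega
  -- (F1) every avoiding permutation monomial splits with non-zero coefficients
  have F1 : ∀ π : Equiv.Perm n, Avoids N π →
      coeff ((permMonomial π).filter (· ∈ S)) g * coeff ((permMonomial π).filter (¬ · ∈ S)) h = 1 :=
    fun π hπ => by rw [← coeff_mul_of_separated S hgS hhS, hgh, coeff_permMonomial_perPat, if_pos hπ]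
  -- (F2) hybrids of avoiding permutations are permutation monomials
  have F2 : ∀ π π' : Equiv.Perm n, Avoids N π → Avoids N π' → ∃ ρ : Equiv.Perm n, permMonomial ρ =
      (permMonomial π).filter (· ∈ S) + (permMonomial π').filter (¬ · ∈ S) := by
    intro π π' hπ hπ'
    set ν := (permMonomial π).filter (· ∈ S) + (permMonomial π').filter (¬ · ∈ S) with hν
    have e1 : ν.filter (· ∈ S) = (permMonomial π).filter (· ∈ S) := by
      ext v; simp only [hν, Finsupp.filter_apply, Finsupp.add_apply]
      by_cases hv : v ∈ S <;> simp [hv]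
    have e2 : ν.filter (¬ · ∈ S) = (permMonomial π').filter (¬ · ∈ S) := by
      ext v; simp only [hν, Finsupp.filter_apply, Finsupp.add_apply]
      by_cases hv : v ∈ S <;> simp [hv]
    have hcoeff : coeff ν (g * h) ≠ 0 := by
      rw [coeff_mul_of_separated S hgS hhS, e1, e2]
      have a := F1 π hπ
      have b := F1 π' hπ'
      exact mul_ne_zero (left_ne_zero_of_mul (a.symm ▸ one_ne_zero))
        (right_ne_zero_of_mul (b.symm ▸ one_ne_zero))
    rw [hgh] at hcoeff
    obtain ⟨ρ, -, hρ⟩ := exists_of_coeff_perPat_ne_zero R hcoeff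
    exact ⟨ρ, hρ⟩
  -- (F3) rows: moves between free cells of a row stay in `S`
  have F3 : ∀ r b b', (r, b) ∉ N → (r, b') ∉ N → (r, b) ∈ S → (r, b') ∈ S := by
    intro r b b' hb hb' hrb
    obtain ⟨π, hπb, hπ⟩ := exists_perm_through_avoids N hN (r, b) hb
    obtain ⟨π', hπb', hπ'⟩ := exists_perm_through_avoids N hN (r, b') hb'
    obtain ⟨ρ, hρ⟩ := F2 π π' hπ hπ'
    have e1 : π.symm r = b := π.symm_apply_eq.2 hπb.symm
    have e2 : π'.symm r = b' := π'.symm_apply_eq.2 hπb'.symm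
    have := rowCount_permMonomial ρ r
    rw [hρ, rowCount_add, rowCount_filter_permMonomial, rowCount_filter_permMonomial, e1, e2, if_pos hrb] at this
    by_contra hb'S
    rw [if_pos hb'S] at this
    omega
  -- (F4) columns
  have F4 : ∀ c a a', (a, c) ∉ N → (a', c) ∉ N → (a, c) ∈ S → (a', c) ∈ S := by
    intro c a a' ha ha' hac
    obtain ⟨π, hπa, hπ⟩ := exists_perm_through_avoids N hN (a, c) ha
    obtain ⟨π', hπa', hπ'⟩ := exists_perm_through_avoids N hN (a', c) ha'
    obtain ⟨ρ, hρ⟩ := F2 π π' hπ hπ'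
    have := colCount_permMonomial ρ c
    rw [hρ, colCount_add, colCount_filter_permMonomial, colCount_filter_permMonomial] at this
    simp only at hπa hπa'
    rw [hπa, hπa', if_pos hac] at this
    by_contra ha'S
    rw [if_pos ha'S] at this
    omega
  by_cases hSne : S.Nonempty
  · -- every free cell is in `S`: `h` has no variables
    right
    obtain ⟨⟨a, b⟩, hab⟩ := hSne
    have habN := hSfree _ hab
    obtain ⟨c, hc⟩ := exists_col_notMem N (by omega)
    have hall : ∀ v : n × n, v ∉ N → v ∈ S := fun ⟨i, j⟩ hij =>
      F3 i c j (hc i) hij (F4 c a i (hc a) (hc i) (F3 a b c habN (hc a) hab))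
    intro d hd
    ext v
    rw [Finsupp.zero_apply]
    by_contra hv
    have hvN : v ∉ N := fun hvN => by
      have h1 := monomial_le_degreeOf v hd
      have h2 := hdegN v hvN
      omega
    exact hhS d hd v hv (hall v hvN)
  · left
    intro d hd
    ext v
    rw [Finsupp.zero_apply]
    by_contra hv
    exact hSne ⟨v, hgS d hd v hv⟩

/-- **The pattern permanent with `|N| + 2 ≤ n` zeros is irreducible** (over any integral domain). [this file] -/
theorem perPat_irreducible (N : Finset (n × n)) (hN : N.card + 2 ≤ Fintype.card n) : Irreducible (perPat R N) := by
  classical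
  obtain ⟨π₀, hπ₀⟩ := exists_avoids N hN
  refine ⟨fun hu => ?_, fun g h hgh => ?_⟩
  · obtain ⟨u, hu⟩ := hu
    obtain ⟨c, hc⟩ := exists_col_notMem N (by omega)
    have h1 : degreeOf (c, c) (perPat R N) = 1 := degreeOf_perPat_of_notMem R N hN (hc c)
    have hprod : (u : MvPolynomial (n × n) R) * (↑u⁻¹ : MvPolynomial (n × n) R) = 1 := by
      rw [← Units.val_mul, mul_inv_cancel, Units.val_one]
    have hu0 : (u : MvPolynomial (n × n) R) ≠ 0 := by
      rw [hu]; intro h0; rw [h0, degreeOf_zero] at h1; exact zero_ne_one h1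
    have hui0 : (↑u⁻¹ : MvPolynomial (n × n) R) ≠ 0 := fun h0 => by
      rw [h0, mul_zero] at hprod; exact zero_ne_one hprod
    have := degreeOf_mul_eq (n := (c, c)) hu0 hui0
    rw [hprod, degreeOf_one, hu, h1] at this
    omega
  · rcases vars_factor_perPat_trivial N hN hgh.symm with hg | hh
    · left
      have hgC := eq_C_of_support_subset_zero hg
      have key : coeff 0 g * coeff (permMonomial π₀) h = 1 := by
        have := congrArg (coeff (permMonomial π₀)) hgh
        rw [coeff_permMonomial_perPat, if_pos hπ₀, hgC, coeff_C_mul] at this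
        exact this.symm
      rw [hgC]
      exact (IsUnit.of_mul_eq_one _ key).map C
    · right
      have hhC := eq_C_of_support_subset_zero hh
      have key : coeff (permMonomial π₀) g * coeff 0 h = 1 := by
        have := congrArg (coeff (permMonomial π₀)) hgh
        rw [coeff_permMonomial_perPat, if_pos hπ₀, hhC, mul_comm, coeff_C_mul] at this
        rw [mul_comm]; exact this.symm
      rw [hhC]
      exact (IsUnit.of_mul_eq_one_right _ key).map C

/-- … hence PRIME over a field. [this file] -/
theorem perPat_prime {k : Type*} [Field k] (N : Finset (n × n)) (hN : N.card + 2 ≤ Fintype.card n) :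
    Prime (perPat k N) :=
  UniqueFactorizationMonoid.irreducible_iff_prime.1 (perPat_irreducible N hN)

end Irreducible

end Summit.ValiantsHypothesis.ValiantsHypothesis.Theorems.DefinabilityGapPatternPermanent
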